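import Literature.NumberTheory.Sieve.AsymptoticSieveForPrimesS3Plus
import Literature.NumberTheory.Sieve.AsymptoticSieveForPrimesS1
import HarnessLib

/-!
# Asymptotic sieve for primes: the estimate (8.5) of `S₃(x; y, Z)` (proof)

Trunk T-SIEVE. Source: J. Friedlander, H. Iwaniec, *Asymptotic sieve for primes*, Ann. of Math. 148
(1998) 1041–1065 [FriedlanderIwaniecASP1998] (= arXiv:math/9811186), §8 "Estimation of
`S₃(x; Y, Z)`", p. 1058, displays (8.4)–(8.5). Third of three files; DISCHARGES the named fact
`Literature.NumberTheory.Sieve.fi_asp_S3_estimate` (FI (8.5), `…Decomposition`) MODULO the named fact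
`Literature.NumberTheory.Sieve.fi_moebius_density_cancellation` (FI (2.4), `…Inputs`):
`fi_asp_S3_estimate_of_cancellation : fi_moebius_density_cancellation → fi_asp_S3_estimate`,
using the proved reductions (R) ⟹ (R′) (`fi_reduced_remainder_bound_holds`) and (B) ⟹ (B′) with the
saving `(log x)^{-5}` (`reduced_bilinear_bound_pow`).

## The printed proof (FI §8, end) and its formalisation

"Change the variable of integration `t` into `t/d`, integrate in `z` over `Z < z < eZ` and change `z`
into `z/k` getting `|S'(x; y, Z)| ≤ ∫_Z^x ∫_C^x ∑^♭_{d<D} τ₅(d) |r_d(min{x, sz}) - r_d(max{t, z})|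
dt dz/(tz)`. Now we can apply (R′) obtaining (8.4) `S'(x; y, Z) ≪ A(x)(log x)⁻¹`. Collecting (8.1),
(8.3) and (8.4) we conclude that (8.5) `S₃(x; y, Z) ≪ A(x)(log x)⁻¹`."

* `sum_squarefree_density_sigmaHalf_le`: `∑^♭_{ν ≤ X} g(ν)σ_ν ≪ log X` ((1.8), (1.9)).
* `intervalIntegral_comp_mul_le` (the change `z ↦ z/k` for a nonnegative bounded measurable
  integrand), `SieveSequence.integral_boundary_terms_le`: with (R′) at the points `min(ckz, x) ≤ x`,
  `∫_Z^{eZ} ∑^♭_d ∑_{k∣d} τ(k)² |r_d(min(ckz, x))| dz/z ≤ (1 + log D) · R`.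
* `SieveSequence.abs_fiS3_le_three`: `|S₃| ≤ |S*| + |S'| + |S⁻|` at fixed `z` (the identities of
  `…S3Minus`, `…S3Plus`).
* `fi_asp_S3_estimate_of_cancellation`: in the regime `FIRegime` (`Δ = x^{θ/2}`, `Z = Y = Δ⁻¹√D`,
  `δ = (log x)^α`, `s = 2^{k₀}` admissible, `C₀ = ⌈x/D⌉`, `a₀ = ⌊sy/Δ⌋ ≥ x^{1/4}`): pointwise in
  `z ∈ (Z, eZ]`, `|S⁻| ≤ 8K_B A(x)(log x)^{-3}`, `|S*| ≤ K* A(x)(log x)^{-1}`,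
  `|S'| ≤ 2K_R A(x)(log x)^{-2} + (log x) G(z)` with `∫_Z^{eZ} G(z) dz/z ≤ 4K_R A(x)(log x)^{-2}`;
  integrating (`intervalIntegral.norm_integral_le_of_norm_le`) gives
  `|S₃(x; y, Z)| ≤ (K* + 8K_B + 6K_R) A(x)(log x)^{-1}`.

## Mathlib search

Mathlib: `intervalIntegral.integral_comp_mul_left`, `intervalIntegral.integral_mono_interval`,
`integral_inv`, `Nat.measurable_floor`, `measurable_from_nat`, `harmonic_le_one_add_log`,
`Real.pow_rpow_inv_natCast`; the tree: `…S3Plus`, `…S1` (`eventually_log_rpow_le_mul_rpow`),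
`…S2` (`intervalIntegrable_of_abs_le`, `intervalIntegrable_finset_sum_fun`, `nat_le_four_mul_log_of_two_pow_le`),
`…Assembly` (`measurable_fiS3`, `exists_bound_fiS2_fiS3`, `integral_inv_Ioc_exp_mul`, `fiY_pos_and_ge`,
`eventually_exp_mul_fiY_le_sqrt`), `…Tyz` (`sum_squarefree_density_card_sigmaHalf_le`,
`sum_primesLE_density_le`, `sum_Icc_rpow_neg_three_halves_le`), `…Reduction`
(`fi_reduced_remainder_bound_holds`), `…BilinearStrong` (`reduced_bilinear_bound_pow`).
-/

noncomputable section

open Filter Finset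
open scoped ArithmeticFunction.Moebius ArithmeticFunction.vonMangoldt ArithmeticFunction.zeta
  ArithmeticFunction.omega ArithmeticFunction.sigma

namespace Literature.NumberTheory.Sieve

open MeasureTheory

/-! ### `∑^♭ g(ν) σ_ν ≪ log x` -/

/-- **`∑^♭_{ν ≤ X} g(ν) σ_ν ≤ e^{|c| + |K₉|(log 2)^{-10} + 3K'} log X`** for `X ≥ 2`
(`≤ ∏_{p ≤ X}(1 + g(p)(1 + p^{-1/2})) ≤ exp(∑ g(p) + ∑ g(p)p^{-1/2})`, (1.8), (1.9); compare
`sum_squarefree_density_card_sigmaHalf_le`). [cite: FriedlanderIwaniecASP1998, §4 p. 1053] -/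
theorem sum_squarefree_density_sigmaHalf_le {g : ArithmeticFunction ℝ} (hg : g.IsMultiplicative)
    {K c K₉ : ℝ} (hK : ∀ p : ℕ, p.Prime → 0 ≤ g p ∧ g p < 1 ∧ g p ≤ K / p)
    (h19 : ∀ y : ℝ, 2 ≤ y →
      |(∑ p ∈ Nat.primesLE ⌊y⌋₊, g p) - (Real.log (Real.log y) + c)| ≤ K₉ / Real.log y ^ 10)
    {X : ℕ} (hX : 2 ≤ X) :
    ∑ ν ∈ (Icc 1 X).filter Squarefree, g ν * sigmaHalf ν ≤
      Real.exp (|c| + |K₉| / Real.log 2 ^ 10 + 3 * max K 0) * Real.log X := by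
  have hg0 : ∀ p : ℕ, p.Prime → 0 ≤ g p := fun p hp => (hK p hp).1
  set K' := max K 0 with hK'
  have hgK' : ∀ p : ℕ, p.Prime → g p ≤ K' / p := fun p hp =>
    (hK p hp).2.2.trans (div_le_div_of_nonneg_right (le_max_left _ _) (Nat.cast_nonneg _))
  have h1 : ∀ ν ∈ (Icc 1 X).filter Squarefree, g ν * sigmaHalf ν =
      ∏ p ∈ ν.primeFactors, g p * (1 + (Real.sqrt p)⁻¹) := by
    intro ν hν
    have hsq := (Finset.mem_filter.mp hν).2
    rw [Finset.prod_mul_distrib, hg.prod_primeFactors hsq, sigmaHalf]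
  rw [Finset.sum_congr rfl h1]
  refine (sum_squarefree_prod_primeFactors_le (fun p hp => by
    have := hg0 p hp; positivity) X).trans ?_
  refine (prod_one_add_le_exp_sum _ fun p hp => by
    have := hg0 p (Nat.prime_of_mem_primesLE hp); positivity).trans ?_
  have hlogX : 0 < Real.log X := Real.log_pos (by exact_mod_cast hX)
  rw [show Real.log (X : ℝ) = Real.exp (Real.log (Real.log X)) by rw [Real.exp_log hlogX],
    ← Real.exp_add]
  refine Real.exp_le_exp.mpr ?_
  have hsplit : ∑ p ∈ Nat.primesLE X, g p * (1 + (Real.sqrt p)⁻¹) =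
      ∑ p ∈ Nat.primesLE X, g p + ∑ p ∈ Nat.primesLE X, g p * (Real.sqrt p)⁻¹ := by
    rw [← Finset.sum_add_distrib]
    refine Finset.sum_congr rfl fun p _ => by ring
  rw [hsplit]
  have hA := sum_primesLE_density_le h19 hX
  have hB : ∑ p ∈ Nat.primesLE X, g p * (Real.sqrt p)⁻¹ ≤ 3 * K' := by
    calc ∑ p ∈ Nat.primesLE X, g p * (Real.sqrt p)⁻¹
        ≤ ∑ p ∈ Nat.primesLE X, K' * ((p : ℝ)) ^ (-(3 / 2 : ℝ)) := by
          refine Finset.sum_le_sum fun p hp => ?_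
          have hpp := Nat.prime_of_mem_primesLE hp
          have hp0 : (0 : ℝ) < p := by exact_mod_cast hpp.pos
          have hsq : (Real.sqrt p)⁻¹ = (p : ℝ) ^ (-(1 / 2 : ℝ)) := by
            rw [Real.sqrt_eq_rpow, ← Real.rpow_neg hp0.le]
          have h32 : K' * (p : ℝ) ^ (-(3 / 2 : ℝ)) = K' / p * (p : ℝ) ^ (-(1 / 2 : ℝ)) := by
            rw [show (-(3 / 2 : ℝ)) = (-1) + (-(1 / 2)) by norm_num, Real.rpow_add hp0,
              Real.rpow_neg_one]
            ring
          rw [hsq, h32]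
          exact mul_le_mul_of_nonneg_right (hgK' p hpp) (Real.rpow_nonneg hp0.le _)
      _ = K' * ∑ p ∈ Nat.primesLE X, ((p : ℝ)) ^ (-(3 / 2 : ℝ)) := by rw [Finset.mul_sum]
      _ ≤ K' * ∑ n ∈ Icc 1 X, ((n : ℝ)) ^ (-(3 / 2 : ℝ)) := by
          refine mul_le_mul_of_nonneg_left ?_ (le_max_right _ _)
          refine Finset.sum_le_sum_of_subset_of_nonneg (fun p hp => ?_) fun n _ _ => by positivity
          obtain ⟨hpX, hpp⟩ := Nat.mem_primesLE.mp hp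
          exact Finset.mem_Icc.mpr ⟨hpp.pos, hpX⟩
      _ ≤ K' * 3 := mul_le_mul_of_nonneg_left (sum_Icc_rpow_neg_three_halves_le X) (le_max_right _ _)
      _ = 3 * K' := by ring
  linarith [hA, hB]

/-! ### The `z`-integration of the boundary remainder terms -/

/-- **Change of variables `u = kz`** (FI §8: "integrate in `z` over `Z < z < eZ` and change `z`
into `z/k`"): for a nonnegative bounded measurable `h`, `Z > 0`, `1 ≤ k` and `e k Z ≤ W`,
`∫_Z^{eZ} h(kz) dz/z = ∫_{kZ}^{ekZ} h(u) du/u ≤ ∫_Z^{W} h(u) du/u`.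
[cite: FriedlanderIwaniecASP1998, §8 (8.4)] -/
theorem intervalIntegral_comp_mul_le {h : ℝ → ℝ} (hm : Measurable h) (h0 : ∀ u, 0 ≤ h u) {M : ℝ}
    (hM : ∀ u, h u ≤ M) {Z k W : ℝ} (hZ : 0 < Z) (hk : 1 ≤ k) (hkW : Real.exp 1 * k * Z ≤ W) :
    ∫ z in Z..(Real.exp 1 * Z), h (k * z) / z ≤ ∫ u in Z..W, h u / u := by
  have hk0 : 0 < k := by linarith
  have he1 : (1 : ℝ) ≤ Real.exp 1 := by linarith [Real.add_one_le_exp (1 : ℝ)]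
  have hM0 : 0 ≤ M := (h0 0).trans (hM 0)
  have hcv : ∫ z in Z..(Real.exp 1 * Z), h (k * z) / z = ∫ u in (k * Z)..(k * (Real.exp 1 * Z)), h u / u := by
    have hfun : (fun z : ℝ => h (k * z) / z) = fun z => k * ((fun u : ℝ => h u / u) (k * z)) := by
      ext z
      show h (k * z) / z = k * (h (k * z) / (k * z))
      rw [← mul_div_assoc, mul_div_mul_left _ _ hk0.ne']
    rw [hfun, intervalIntegral.integral_const_mul,
      intervalIntegral.integral_comp_mul_left (fun u : ℝ => h u / u) hk0.ne',
      smul_eq_mul, mul_inv_cancel_left₀ hk0.ne']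
  rw [hcv]
  have hca : Z ≤ k * Z := le_mul_of_one_le_left hZ.le hk
  have hab : k * Z ≤ k * (Real.exp 1 * Z) :=
    mul_le_mul_of_nonneg_left (le_mul_of_one_le_left hZ.le he1) hk0.le
  have hbd : k * (Real.exp 1 * Z) ≤ W := by nlinarith
  refine intervalIntegral.integral_mono_interval hca hab hbd ?_ ?_
  · refine MeasureTheory.ae_restrict_of_forall_mem measurableSet_Ioc fun u hu => ?_
    exact div_nonneg (h0 u) (hZ.le.trans hu.1.le)
  · refine intervalIntegrable_of_abs_le (f := fun u : ℝ => h u / u)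
      (hm.div measurable_id : Measurable fun u : ℝ => h u / u) (M := M / Z) fun u hu => ?_
    rw [Set.uIoc_of_le (hca.trans (hab.trans hbd))] at hu
    have hu0 : 0 < u := hZ.trans hu.1
    rw [abs_of_nonneg (div_nonneg (h0 u) hu0.le)]
    calc h u / u ≤ M / u := div_le_div_of_nonneg_right (hM u) hu0.le
      _ ≤ M / Z := div_le_div_of_nonneg_left hM0 hZ hu.1.le

namespace SieveSequence

/-- `t ↦ A_d(t)` is measurable (a step function of `⌊t⌋`). [folklore] -/
theorem measurable_congrSum (A : SieveSequence) (d : ℕ) : Measurable fun t : ℝ => A.congrSum d t := by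
  have : (fun t : ℝ => A.congrSum d t) =
      (fun N : ℕ => ∑ n ∈ (Ioc 0 N).filter (d ∣ ·), A.a n) ∘ Nat.floor := rfl
  rw [this]
  exact measurable_from_nat.comp Nat.measurable_floor

/-- `t ↦ r_d(t)` is measurable under the size normalisation. [folklore] -/
theorem measurable_remainder (A : SieveSequence) (hsize : ∀ t, A.size t = A.congrSum 1 t) (d : ℕ) :
    Measurable fun t : ℝ => A.remainder d t := by
  have : (fun t : ℝ => A.remainder d t) = fun t => A.congrSum d t - A.density d * A.congrSum 1 t := by
    ext t; rw [remainder, hsize]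
  rw [this]
  exact (A.measurable_congrSum d).sub ((A.measurable_congrSum 1).const_mul _)

/-- `|r_d(t)| ≤ ∑_{n ≤ x} a_n · (1 + |g(d)|)` for `t ≤ x` (crude bound for integrability). [folklore] -/
theorem abs_remainder_le (A : SieveSequence) (hsize : ∀ t, A.size t = A.congrSum 1 t) (d : ℕ)
    {t x : ℝ} (htx : t ≤ x) :
    |A.remainder d t| ≤ (∑ n ∈ Icc 1 ⌊x⌋₊, A.a n) * (1 + |A.density d|) := by
  have hS0 : 0 ≤ ∑ n ∈ Icc 1 ⌊x⌋₊, A.a n := Finset.sum_nonneg fun n _ => A.a_nonneg n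
  have hcs : ∀ e : ℕ, |A.congrSum e t| ≤ ∑ n ∈ Icc 1 ⌊x⌋₊, A.a n := by
    intro e
    rw [congrSum, abs_of_nonneg (Finset.sum_nonneg fun n _ => A.a_nonneg n)]
    have hIcc : Ioc 0 ⌊t⌋₊ ⊆ Icc 1 ⌊x⌋₊ := fun n hn => by
      obtain ⟨h1, h2⟩ := Finset.mem_Ioc.mp hn
      exact Finset.mem_Icc.mpr ⟨h1, h2.trans (Nat.floor_le_floor htx)⟩
    exact (Finset.sum_le_sum_of_subset_of_nonneg (Finset.filter_subset _ _) fun n _ _ => A.a_nonneg n).trans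
      (Finset.sum_le_sum_of_subset_of_nonneg hIcc fun n _ _ => A.a_nonneg n)
  rw [remainder, hsize]
  calc |A.congrSum d t - A.density d * A.congrSum 1 t|
      ≤ |A.congrSum d t| + |A.density d * A.congrSum 1 t| := abs_sub _ _
    _ ≤ (∑ n ∈ Icc 1 ⌊x⌋₊, A.a n) + |A.density d| * ∑ n ∈ Icc 1 ⌊x⌋₊, A.a n := by
        rw [abs_mul]
        exact add_le_add (hcs d) (mul_le_mul_of_nonneg_left (hcs 1) (abs_nonneg _))
    _ = (∑ n ∈ Icc 1 ⌊x⌋₊, A.a n) * (1 + |A.density d|) := by ring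

/-- **The boundary remainder terms, integrated over `z`** (FI §8, (8.4): after the changes of
variables, "Now we can apply (R′) obtaining `S'(x; y, Z) ≪ A(x)(log x)⁻¹`"): if
`∑^♭_{d ≤ D_n} τ₅(d)|r_d(t)| ≤ R` for all `t ≤ x`, then for `Z > 0`, any real `c`, and `D_n ≥ 1`,
`∫_Z^{eZ} ∑^♭_{d ≤ D_n} ∑_{k∣d} τ(k)² |r_d(min(ckz, x))| dz/z ≤ (1 + log D_n) R`.
[cite: FriedlanderIwaniecASP1998, §8 (8.4)] -/
theorem integral_boundary_terms_le (A : SieveSequence) (hsize : ∀ t, A.size t = A.congrSum 1 t)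
    {x : ℝ} {Dn : ℕ} (hDn : 1 ≤ Dn) {R : ℝ}
    (hR : ∀ t : ℝ, t ≤ x → ∑ d ∈ (Icc 1 Dn).filter Squarefree, (divisorCountK 5 d : ℝ) * |A.remainder d t| ≤ R)
    {Z : ℝ} (hZ : 0 < Z) (c : ℝ) :
    ∫ z in Z..(Real.exp 1 * Z), (∑ d ∈ (Icc 1 Dn).filter Squarefree, ∑ k ∈ d.divisors,
        ((k.divisors.card : ℝ)) ^ 2 * |A.remainder d (min (c * ((k : ℝ) * z)) x)|) / z ≤
      (1 + Real.log Dn) * R := by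
  classical
  set S := (Icc 1 Dn).filter Squarefree with hS
  set W := Real.exp 1 * Dn * Z with hW
  have he1 : (1 : ℝ) ≤ Real.exp 1 := by linarith [Real.add_one_le_exp (1 : ℝ)]
  have hDn1 : (1 : ℝ) ≤ Dn := by exact_mod_cast hDn
  have hZe : Z ≤ Real.exp 1 * Z := le_mul_of_one_le_left hZ.le he1
  have hZW : Z ≤ W := by rw [hW]; nlinarith
  have hR0 : 0 ≤ R := le_trans (Finset.sum_nonneg fun d _ => by positivity) (hR x le_rfl)
  -- the integrands
  set F : ℕ → ℝ → ℝ := fun d u => |A.remainder d (min (c * u) x)| with hF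
  have hFm : ∀ d, Measurable (F d) := fun d =>
    (continuous_abs.measurable.comp ((A.measurable_remainder hsize d).comp
      ((measurable_id.const_mul c).min measurable_const)))
  have hF0 : ∀ d u, 0 ≤ F d u := fun d u => abs_nonneg _
  set M := (∑ n ∈ Icc 1 ⌊x⌋₊, A.a n) * (1 + ∑ d ∈ S, |A.density d|) with hM
  have hFM : ∀ d ∈ S, ∀ u, F d u ≤ M := by
    intro d hd u
    refine (A.abs_remainder_le hsize d (min_le_right _ _)).trans ?_
    refine mul_le_mul_of_nonneg_left ?_ (Finset.sum_nonneg fun n _ => A.a_nonneg n)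
    exact add_le_add le_rfl (Finset.single_le_sum (f := fun d => |A.density d|) (fun d _ => abs_nonneg _) hd)
  -- Step 1: pull the sums out and substitute `u = kz`
  have hpiece : ∀ d ∈ S, ∀ k ∈ d.divisors, ∀ {a b : ℝ}, 0 < a → a ≤ b →
      IntervalIntegrable (fun z => F d ((k : ℝ) * z) / z) volume a b := by
    intro d hd k _ a b ha hab
    refine intervalIntegrable_of_abs_le (f := fun z => F d ((k : ℝ) * z) / z)
      (((hFm d).comp (measurable_const.mul measurable_id)).div measurable_id)
      (M := M / a) fun z hz => ?_
    rw [Set.uIoc_of_le hab] at hz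
    have hz0 : 0 < z := ha.trans hz.1
    show |F d (k * z) / z| ≤ M / a
    rw [abs_of_nonneg (div_nonneg (hF0 _ _) hz0.le)]
    calc F d (k * z) / z ≤ M / z := div_le_div_of_nonneg_right (hFM d hd _) hz0.le
      _ ≤ M / a := div_le_div_of_nonneg_left (le_trans (hF0 d 0) (hFM d hd 0)) ha hz.1.le
  have hstep1 : ∫ z in Z..(Real.exp 1 * Z), (∑ d ∈ S, ∑ k ∈ d.divisors,
      ((k.divisors.card : ℝ)) ^ 2 * |A.remainder d (min (c * ((k : ℝ) * z)) x)|) / z =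
      ∑ d ∈ S, ∑ k ∈ d.divisors, ((k.divisors.card : ℝ)) ^ 2 *
        ∫ z in Z..(Real.exp 1 * Z), F d ((k : ℝ) * z) / z := by
    have hfun : (fun z : ℝ => (∑ d ∈ S, ∑ k ∈ d.divisors,
        ((k.divisors.card : ℝ)) ^ 2 * |A.remainder d (min (c * ((k : ℝ) * z)) x)|) / z) =
        fun z => ∑ d ∈ S, ∑ k ∈ d.divisors, ((k.divisors.card : ℝ)) ^ 2 * (F d ((k : ℝ) * z) / z) := by
      ext z
      rw [Finset.sum_div]
      refine Finset.sum_congr rfl fun d _ => ?_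
      rw [Finset.sum_div]
      refine Finset.sum_congr rfl fun k _ => ?_
      rw [hF]; ring
    rw [hfun, intervalIntegral.integral_finsetSum (fun d hd =>
      intervalIntegrable_finset_sum_fun _ fun k hk => (hpiece d hd k hk hZ hZe).const_mul _)]
    refine Finset.sum_congr rfl fun d hd => ?_
    rw [intervalIntegral.integral_finsetSum (fun k hk => (hpiece d hd k hk hZ hZe).const_mul _)]
    refine Finset.sum_congr rfl fun k _ => ?_
    exact intervalIntegral.integral_const_mul _ _
  rw [hstep1]
  -- Step 2: substitute and bound each `k`-integral by the `k`-free one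
  have hstep2 : ∀ d ∈ S, ∀ k ∈ d.divisors,
      ∫ z in Z..(Real.exp 1 * Z), F d ((k : ℝ) * z) / z ≤ ∫ u in Z..W, F d u / u := by
    intro d hd k hk
    have hk1 : (1 : ℝ) ≤ k := by exact_mod_cast Nat.pos_of_mem_divisors hk
    have hkD : (k : ℝ) ≤ Dn := by
      have := Nat.divisor_le hk
      have hdD := (Finset.mem_Icc.mp (Finset.mem_filter.mp hd).1).2
      exact_mod_cast this.trans hdD
    refine intervalIntegral_comp_mul_le (hFm d) (hF0 d) (hFM d hd) hZ hk1 ?_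
    rw [hW]
    exact mul_le_mul_of_nonneg_right (mul_le_mul_of_nonneg_left hkD (Real.exp_pos 1).le) hZ.le
  have hstep3 : ∑ d ∈ S, ∑ k ∈ d.divisors, ((k.divisors.card : ℝ)) ^ 2 *
      ∫ z in Z..(Real.exp 1 * Z), F d ((k : ℝ) * z) / z ≤
      ∑ d ∈ S, (divisorCountK 5 d : ℝ) * ∫ u in Z..W, F d u / u := by
    refine Finset.sum_le_sum fun d hd => ?_
    have hdsq := (Finset.mem_filter.mp hd).2
    rw [← sum_divisors_card_divisors_sq hdsq, Finset.sum_mul]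
    exact Finset.sum_le_sum fun k hk => mul_le_mul_of_nonneg_left (hstep2 d hd k hk) (sq_nonneg _)
  refine hstep3.trans ?_
  -- Step 3: swap sum and integral, apply (R′) pointwise
  have hpieceU : ∀ d ∈ S, IntervalIntegrable (fun u => F d u / u) volume Z W := by
    intro d hd
    have := hpiece d hd 1 (Nat.one_mem_divisors.mpr (Finset.mem_filter.mp hd).2.ne_zero) hZ hZW
    simpa using this
  have hswapI : ∑ d ∈ S, (divisorCountK 5 d : ℝ) * ∫ u in Z..W, F d u / u =
      ∫ u in Z..W, ∑ d ∈ S, (divisorCountK 5 d : ℝ) * (F d u / u) := by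
    rw [intervalIntegral.integral_finsetSum (fun d hd => (hpieceU d hd).const_mul _)]
    exact Finset.sum_congr rfl fun d _ => (intervalIntegral.integral_const_mul _ _).symm
  rw [hswapI]
  have hptw : ∀ u ∈ Set.Ioo Z W, ∑ d ∈ S, (divisorCountK 5 d : ℝ) * (F d u / u) ≤ R * u⁻¹ := by
    intro u hu
    have hu0 : 0 < u := hZ.trans hu.1
    have h1 : ∑ d ∈ S, (divisorCountK 5 d : ℝ) * (F d u / u) =
        (∑ d ∈ S, (divisorCountK 5 d : ℝ) * |A.remainder d (min (c * u) x)|) * u⁻¹ := by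
      rw [Finset.sum_mul]
      refine Finset.sum_congr rfl fun d _ => ?_
      rw [hF, div_eq_mul_inv]; ring
    rw [h1]
    exact mul_le_mul_of_nonneg_right (hR _ (min_le_right _ _)) (inv_nonneg.mpr hu0.le)
  have hinv : IntervalIntegrable (fun u : ℝ => R * u⁻¹) volume Z W := by
    refine (intervalIntegral.intervalIntegrable_inv (fun u hu => ?_) continuousOn_id).const_mul _
    rw [Set.uIcc_of_le hZW] at hu
    exact (hZ.trans_le hu.1).ne'
  calc ∫ u in Z..W, ∑ d ∈ S, (divisorCountK 5 d : ℝ) * (F d u / u)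
      ≤ ∫ u in Z..W, R * u⁻¹ :=
        intervalIntegral.integral_mono_on_of_le_Ioo hZW
          (intervalIntegrable_finset_sum_fun _ fun d hd => (hpieceU d hd).const_mul _) hinv hptw
    _ = R * Real.log (W / Z) := by
        rw [intervalIntegral.integral_const_mul, integral_inv (Set.notMem_uIcc_of_lt hZ (hZ.trans_le hZW))]
    _ = (1 + Real.log Dn) * R := by
        rw [hW, show Real.exp 1 * Dn * Z / Z = Real.exp 1 * Dn by field_simp,
          Real.log_mul (Real.exp_pos 1).ne' (by positivity), Real.log_exp]
        ring

/-- Interval integrability of the boundary-term majorant `z ↦ (∑^♭_d ∑_{k∣d} τ(k)² |r_d(min(ckz, x))|)/z`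
on `[Z, eZ]`, `Z > 0`. [folklore] -/
theorem intervalIntegrable_boundary_terms (A : SieveSequence) (hsize : ∀ t, A.size t = A.congrSum 1 t)
    (x : ℝ) (Dn : ℕ) {Z W : ℝ} (hZ : 0 < Z) (hZW : Z ≤ W) (c : ℝ) :
    IntervalIntegrable (fun z : ℝ => (∑ d ∈ (Icc 1 Dn).filter Squarefree, ∑ k ∈ d.divisors,
        ((k.divisors.card : ℝ)) ^ 2 * |A.remainder d (min (c * ((k : ℝ) * z)) x)|) / z) volume Z W := by
  classical
  set S := (Icc 1 Dn).filter Squarefree with hS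
  set F : ℕ → ℝ → ℝ := fun d u => |A.remainder d (min (c * u) x)| with hF
  have hFm : ∀ d, Measurable (F d) := fun d =>
    (continuous_abs.measurable.comp ((A.measurable_remainder hsize d).comp
      ((measurable_id.const_mul c).min measurable_const)))
  have hF0 : ∀ d u, 0 ≤ F d u := fun d u => abs_nonneg _
  set M := (∑ n ∈ Icc 1 ⌊x⌋₊, A.a n) * (1 + ∑ d ∈ S, |A.density d|) with hM
  have hFM : ∀ d ∈ S, ∀ u, F d u ≤ M := by
    intro d hd u
    refine (A.abs_remainder_le hsize d (min_le_right _ _)).trans ?_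
    refine mul_le_mul_of_nonneg_left ?_ (Finset.sum_nonneg fun n _ => A.a_nonneg n)
    exact add_le_add le_rfl (Finset.single_le_sum (f := fun d => |A.density d|) (fun d _ => abs_nonneg _) hd)
  have hpiece : ∀ d ∈ S, ∀ k ∈ d.divisors,
      IntervalIntegrable (fun z => ((k.divisors.card : ℝ)) ^ 2 * (F d ((k : ℝ) * z) / z)) volume Z W := by
    intro d hd k _
    refine IntervalIntegrable.const_mul ?_ _
    refine intervalIntegrable_of_abs_le (f := fun z => F d ((k : ℝ) * z) / z)
      (((hFm d).comp (measurable_const.mul measurable_id)).div measurable_id)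
      (M := M / Z) fun z hz => ?_
    rw [Set.uIoc_of_le hZW] at hz
    have hz0 : 0 < z := hZ.trans hz.1
    show |F d (k * z) / z| ≤ M / Z
    rw [abs_of_nonneg (div_nonneg (hF0 _ _) hz0.le)]
    calc F d (k * z) / z ≤ M / z := div_le_div_of_nonneg_right (hFM d hd _) hz0.le
      _ ≤ M / Z := div_le_div_of_nonneg_left (le_trans (hF0 d 0) (hFM d hd 0)) hZ hz.1.le
  have hfun : (fun z : ℝ => (∑ d ∈ S, ∑ k ∈ d.divisors,
      ((k.divisors.card : ℝ)) ^ 2 * |A.remainder d (min (c * ((k : ℝ) * z)) x)|) / z) =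
      fun z => ∑ d ∈ S, ∑ k ∈ d.divisors, ((k.divisors.card : ℝ)) ^ 2 * (F d ((k : ℝ) * z) / z) := by
    ext z
    rw [Finset.sum_div]
    refine Finset.sum_congr rfl fun d _ => ?_
    rw [Finset.sum_div]
    refine Finset.sum_congr rfl fun k _ => ?_
    rw [hF]; ring
  rw [hfun]
  exact intervalIntegrable_finset_sum_fun _ fun d hd =>
    intervalIntegrable_finset_sum_fun _ fun k hk => hpiece d hd k hk

/-- Measurability of `z ↦ S₃(x; y, z)` for fixed `y`. [folklore] -/
theorem measurable_fiS3_right (A : SieveSequence) (lam : ℕ → ℤ) (s x y : ℝ) :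
    Measurable fun z : ℝ => A.fiS3 lam s x y z := by
  have h := (A.measurable_fiS3 lam s x).comp
    ((measurable_const : Measurable fun _ : ℝ => y).prodMk measurable_id)
  simpa only [Function.comp_def, Function.uncurry_apply_pair, id_eq] using h

/-- **`|S₃| ≤ |S*| + |S'| + |S⁻|`** (FI §8: `μ(c)Λ(c) = λ⁺(c) - λ⁻(c)`, `S⁺ = S* + S'` by (8.2) and
(1.7)), the structural inequality at a fixed `z` (for weights of sifting range `P ≤ z`, `z ≥ 1`,
`x ≥ 0`, an integer truncation `C₀ ≥ 1`). [cite: FriedlanderIwaniecASP1998, §8 (8.1)-(8.4)] -/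
theorem abs_fiS3_le_three (A : SieveSequence) (h116 : ∀ n : ℕ, ¬Squarefree n → A.a n = 0)
    {P L : ℝ} {lam : ℕ → ℤ} (hw : IsUpperSieveWeights P L lam) {s x y z : ℝ} (hPz : P ≤ z)
    (hz1 : 1 ≤ z) (hx : 0 ≤ x) {C₀ : ℕ} (hC : 1 ≤ C₀) :
    |A.fiS3 lam s x y z| ≤
      |∑ k ∈ Icc 1 ⌊x⌋₊, ∑ ℓ ∈ Icc 1 (⌊x⌋₊ / k),
        (if Squarefree (k * ℓ) then
          (truncGT (μ : ArithmeticFunction ℝ) (s * y) * ζ) k * (sieveRho lam k : ℝ) * (μ ℓ : ℝ) *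
            (A.density (k * ℓ) * ∑ n ∈ Icc 1 ⌊x⌋₊,
              (if (k : ℝ) * z < n ∧ (n : ℝ) ≤ k * (s * z) ∧ (n : ℝ) ≤ x then
                Real.posLog ((n : ℝ) / ((k * ℓ * C₀ : ℕ) : ℝ)) else 0) * A.a n)
        else 0)| +
      |∑ k ∈ Icc 1 ⌊x⌋₊, ∑ ℓ ∈ Icc 1 (⌊x⌋₊ / k),
        (if Squarefree (k * ℓ) then
          (truncGT (μ : ArithmeticFunction ℝ) (s * y) * ζ) k * (sieveRho lam k : ℝ) * (μ ℓ : ℝ) *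
          (∑ n ∈ (Icc 1 ⌊x⌋₊).filter (fun n => k * ℓ ∣ n),
              (if (k : ℝ) * z < n ∧ (n : ℝ) ≤ k * (s * z) ∧ (n : ℝ) ≤ x then
                Real.posLog ((n : ℝ) / ((k * ℓ * C₀ : ℕ) : ℝ)) else 0) * A.a n -
            A.density (k * ℓ) * ∑ n ∈ Icc 1 ⌊x⌋₊,
              (if (k : ℝ) * z < n ∧ (n : ℝ) ≤ k * (s * z) ∧ (n : ℝ) ≤ x then
                Real.posLog ((n : ℝ) / ((k * ℓ * C₀ : ℕ) : ℝ)) else 0) * A.a n)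
        else 0)| +
      |∑ c ∈ Icc 1 ⌊x⌋₊, ∑ k ∈ Icc 1 (⌊x⌋₊ / c),
        (if z < (c : ℝ) ∧ (c : ℝ) ≤ s * z then
          (truncGT (μ : ArithmeticFunction ℝ) (s * y) * ζ) k * (sieveRho lam k : ℝ) *
            ((μ c : ℝ) * ∑ m ∈ c.divisors, (μ m : ℝ) * Real.posLog ((C₀ : ℝ) / m)) * A.a (k * c)
        else 0)| := by
  classical
  set X := ⌊x⌋₊ with hX
  rw [A.fiS3_eq_plus_sub_minus h116 hw hPz hz1 hC,
    S3plus_eq_sum_k_l h116 (fun k => (truncGT (μ : ArithmeticFunction ℝ) (s * y) * ζ) k) lam X C₀ z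
      (s * z)]
  -- abbreviations for the smooth sums
  set φ : ℕ → ℕ → ℕ → ℝ := fun k ℓ n =>
    if (k : ℝ) * z < n ∧ (n : ℝ) ≤ k * (s * z) ∧ (n : ℝ) ≤ x then
      Real.posLog ((n : ℝ) / ((k * ℓ * C₀ : ℕ) : ℝ)) else 0 with hφ
  set Qf : ℕ → ℕ → ℝ := fun k ℓ => ∑ n ∈ (Icc 1 X).filter (fun n => k * ℓ ∣ n), φ k ℓ n * A.a n with hQf
  set Q1 : ℕ → ℕ → ℝ := fun k ℓ => ∑ n ∈ Icc 1 X, φ k ℓ n * A.a n with hQ1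
  set Mf : ℕ → ℝ := fun k => (truncGT (μ : ArithmeticFunction ℝ) (s * y) * ζ) k with hMf
  -- the `m`-sums are the `Qf`
  have hQ : ∀ k ∈ Icc 1 X, ∀ ℓ ∈ Icc 1 (X / k),
      ∑ m ∈ Icc 1 (X / k / ℓ), (if z < ((ℓ * m : ℕ) : ℝ) ∧ ((ℓ * m : ℕ) : ℝ) ≤ s * z then
        Real.posLog ((m : ℝ) / C₀) * A.a (k * (ℓ * m)) else 0) = Qf k ℓ := by
    intro k hk ℓ hℓ
    rw [hX] at *
    exact sum_m_eq_sum_filter_dvd A.a (Finset.mem_Icc.mp hk).1 (Finset.mem_Icc.mp hℓ).1 hx C₀ z s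
  -- split `Mf ρ μ Qf = [sqf](Mf ρ μ (g Q1)) + [sqf](Mf ρ μ (Qf - g Q1))`
  have hsplit : ∀ k ∈ Icc 1 X, ∀ ℓ ∈ Icc 1 (X / k),
      Mf k * (sieveRho lam k : ℝ) * (μ ℓ : ℝ) * Qf k ℓ =
        (if Squarefree (k * ℓ) then Mf k * (sieveRho lam k : ℝ) * (μ ℓ : ℝ) *
          (A.density (k * ℓ) * Q1 k ℓ) else 0) +
        (if Squarefree (k * ℓ) then Mf k * (sieveRho lam k : ℝ) * (μ ℓ : ℝ) *
          (Qf k ℓ - A.density (k * ℓ) * Q1 k ℓ) else 0) := by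
    intro k _ ℓ _
    split_ifs with hsq
    · ring
    · have hQ0 : Qf k ℓ = 0 := by
        rw [hQf]
        refine Finset.sum_eq_zero fun n hn => ?_
        have hdvd := (Finset.mem_filter.mp hn).2
        rw [h116 n (fun h => hsq (h.squarefree_of_dvd hdvd)), mul_zero]
      rw [hQ0, mul_zero, add_zero]
  have hplus : ∑ k ∈ Icc 1 X, ∑ ℓ ∈ Icc 1 (X / k), Mf k * (sieveRho lam k : ℝ) * (μ ℓ : ℝ) *
      ∑ m ∈ Icc 1 (X / k / ℓ), (if z < ((ℓ * m : ℕ) : ℝ) ∧ ((ℓ * m : ℕ) : ℝ) ≤ s * z then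
        Real.posLog ((m : ℝ) / C₀) * A.a (k * (ℓ * m)) else 0) =
      (∑ k ∈ Icc 1 X, ∑ ℓ ∈ Icc 1 (X / k),
        (if Squarefree (k * ℓ) then Mf k * (sieveRho lam k : ℝ) * (μ ℓ : ℝ) *
          (A.density (k * ℓ) * Q1 k ℓ) else 0)) +
      ∑ k ∈ Icc 1 X, ∑ ℓ ∈ Icc 1 (X / k),
        (if Squarefree (k * ℓ) then Mf k * (sieveRho lam k : ℝ) * (μ ℓ : ℝ) *
          (Qf k ℓ - A.density (k * ℓ) * Q1 k ℓ) else 0) := by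
    rw [← Finset.sum_add_distrib]
    refine Finset.sum_congr rfl fun k hk => ?_
    rw [← Finset.sum_add_distrib]
    refine Finset.sum_congr rfl fun ℓ hℓ => ?_
    rw [hQ k hk ℓ hℓ, hsplit k hk ℓ hℓ]
  rw [hplus]
  exact (abs_sub _ _).trans (add_le_add (abs_add_le _ _) le_rfl)

end SieveSequence

/-! ### Assembly: (8.5) -/

/-- **FI (8.5) from (2.4)**: `S₃(x; y, Z) ≪ A(x)(log x)⁻¹` — discharge of the named fact
`fi_asp_S3_estimate` modulo the Möbius–density cancellation `fi_moebius_density_cancellation`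
(FI (2.4)), using the PROVED reductions (R) ⟹ (R′) (`fi_reduced_remainder_bound_holds`) and
(B) ⟹ (B′) with saving `(log x)^{-5}` (`reduced_bilinear_bound_pow`). FI §8: "Collecting (8.1),
(8.3) and (8.4) we conclude that (8.5) `S₃(x; y, Z) ≪ A(x)(log x)⁻¹`." Here: `|S₃(x;y,z)| ≤ |S*| +
|S'| + |S⁻|` pointwise in `z ∈ (Z, eZ]` (`abs_fiS3_le_three`), with `|S⁻| ≤ log C₀ · log₂ s · K_B
A(x)(log x)^{-5}` (`abs_S3minus_le`, (B′) on the dyadic pieces of `(z, sz]` for every integer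
truncation `j < C₀ = ⌈x/D⌉`), `|S*| ≪ A(x)(log x)^{2+1+1+1-6}` (`abs_S3star_le` with (2.4), the
bounds `∑^♭ gτσ ≪ log²x`, `∑^♭ gσ ≪ log x`, and `log⌊sy/Δ⌋ ≥ ¼ log x`), and `|S'| ≤ P₁ + (log x)G(z)`
(`abs_S3prime_le`) where `P₁ = ∑_n n⁻¹ ∑^♭_d τ₅(d)|r_d(n)| ≤ (1 + log x) K_R A(x)(log x)^{-3}` by (R′)
and `∫_Z^{eZ} G(z) dz/z ≤ 2(1 + log D) K_R A(x)(log x)^{-3}` by the change of variables `u = kz` and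
(R′) (`integral_boundary_terms_le`). [cite: FriedlanderIwaniecASP1998, §8 (8.5)] -/
theorem fi_asp_S3_estimate_of_cancellation (h24 : fi_moebius_density_cancellation) :
    fi_asp_S3_estimate := by
  intro A D α θ θ₁ lam hreg
  classical
  have hhyp := hreg.hyp
  have hsize : ∀ t, A.size t = A.congrSum 1 t := hhyp.1
  have h116 : ∀ n : ℕ, ¬Squarefree n → A.a n = 0 := hhyp.2.2.2.2.2.1
  obtain ⟨K, hK⟩ := hhyp.2.2.2.1
  obtain ⟨c₉, K₉, h19⟩ := hhyp.2.2.2.2.1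
  obtain ⟨K₂₄, h24'⟩ := h24 A.density A.density_mult ⟨K, hK⟩ ⟨c₉, K₉, h19⟩
  obtain ⟨K_R, hR'⟩ := fi_reduced_remainder_bound_holds A D _ _ hhyp
  obtain ⟨KB, hKB⟩ := hhyp.reduced_bilinear_bound_pow (k := 5) (by norm_num)
  have hg : A.density.IsMultiplicative := A.density_mult
  have hg0 : ∀ p : ℕ, p.Prime → 0 ≤ A.density p := fun p hp => (hK p hp).1
  have hθ₁ : 0 < θ₁ := hreg.θ₁_pos
  have hθ₁le : θ₁ ≤ θ / 2 := hreg.θ₁_le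
  have hθ : 0 < θ := by linarith
  have hθ3 : θ < 1 / 3 := hreg.θ_lt
  have hα : 0 < α := hreg.α_pos
  -- constants
  set K' := max K 0 with hK'
  set L2 := |K₉| / Real.log 2 ^ 10 with hL2
  set E₂ := Real.exp (2 * (|c₉| + L2) + 6 * K') with hE₂
  set E₁ := Real.exp (|c₉| + L2 + 3 * K') with hE₁
  set Kstar := E₂ * E₁ ^ 2 * (2 * |K₂₄|) * 4 ^ 6 with hKstar
  set KB' := max KB 0 with hKB'
  set KR' := max K_R 0 with hKR'
  have hKB'0 : 0 ≤ KB' := le_max_right _ _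
  have hKR'0 : 0 ≤ KR' := le_max_right _ _
  have hKstar0 : 0 ≤ Kstar := by positivity
  refine ⟨Kstar + 8 * KB' + 6 * KR', ?_⟩
  have hR1 : ∀ᶠ x : ℝ in atTop, x ^ (2 / 3 : ℝ) < D x ∧ D x < x :=
    hhyp.2.2.2.2.2.2.1.mono fun x hx => ⟨hx.1, hx.2.1⟩
  filter_upwards [hreg.weights, hKB, hR', hR1, eventually_exp_mul_fiY_le_sqrt hθ hR1,
    eventually_ge_atTop (16 : ℝ), eventually_ge_atTop (Real.exp 1),
    eventually_log_rpow_le_mul_rpow α (s := 1 / 4 - θ / 2) (c := 1 / 16) (by linarith) (by norm_num),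
    (tendsto_rpow_atTop hθ₁).eventually_ge_atTop (2 : ℝ)]
    with x hw hBx hRx hR1x heY hx16 hxe h16 hP2
  intro s hs y hYy hyY
  -- basic facts at `x`
  have he1 : (1 : ℝ) ≤ Real.exp 1 := by linarith [Real.add_one_le_exp (1 : ℝ)]
  have hx1 : 1 ≤ x := by linarith only [he1, hxe]
  have hx0 : 0 < x := by linarith only [hx1]
  have hlogx : 1 ≤ Real.log x := by rw [Real.le_log_iff_exp_le hx0]; exact hxe
  have hlogx0 : 0 < Real.log x := by linarith only [hlogx]
  have hD0 : 0 < D x := lt_trans (by positivity) hR1x.1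
  have hDx : D x < x := hR1x.2
  have hD1 : 1 ≤ D x := le_trans (Real.one_le_rpow hx1 (by norm_num)) hR1x.1.le
  have hA0 : 0 ≤ A.size x := by rw [hsize]; exact A.congrSum_nonneg 1 x
  obtain ⟨δ, hδ⟩ : ∃ δ : ℝ, δ = Real.log x ^ α := ⟨_, rfl⟩
  have hδ1 : 1 ≤ δ := by rw [hδ]; exact Real.one_le_rpow hlogx hα.le
  have hδ0 : 0 < δ := by linarith only [hδ1]
  have hlα0 : 0 < Real.log x ^ α := Real.rpow_pos_of_pos hlogx0 α
  obtain ⟨Lw, hLw⟩ : ∃ Lw : ℝ, Lw = x ^ (θ / 2) := ⟨_, rfl⟩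
  rw [← hLw] at hw
  set P := x ^ θ₁ with hP
  have hxθ0 : 0 < x ^ (θ / 2) := Real.rpow_pos_of_pos hx0 _
  have hLw0 : 0 < Lw := by rw [hLw]; exact hxθ0
  have hLw1 : 1 ≤ Lw := by rw [hLw]; exact Real.one_le_rpow hx1 (by linarith only [hθ])
  have hP0 : 0 < P := Real.rpow_pos_of_pos hx0 _
  have hsqrt0 : 0 < Real.sqrt x := Real.sqrt_pos.mpr hx0
  set X := ⌊x⌋₊ with hXdef
  have hX2 : 2 ≤ X := Nat.le_floor (by push_cast; linarith only [hx16])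
  have hlogX : Real.log X ≤ Real.log x :=
    Real.log_le_log (by exact_mod_cast (show 0 < X by omega)) (Nat.floor_le hx0.le)
  have hlogX0 : 0 ≤ Real.log X := Real.log_nonneg (by exact_mod_cast (show 1 ≤ X by omega))
  -- `Y`, `u₀`, `s`
  set Y := fiY D θ x with hYdef
  obtain ⟨hY0, hYP⟩ := fiY_pos_and_ge (D := D) (θ := θ) (θ₁ := θ₁) hx1 hR1x.1 (by linarith only [hθ₁le, hθ3])
  obtain ⟨u₀, hu₀⟩ : ∃ u₀ : ℝ, u₀ = Real.sqrt x / (8 * δ) := ⟨_, rfl⟩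
  have hu₀0 : 0 < u₀ := by rw [hu₀]; exact div_pos hsqrt0 (mul_pos (by norm_num) hδ0)
  have hSY : fiSLow D α θ x * Y = u₀ := by
    rw [hu₀, hδ]
    show fiSLow D α θ x * fiY D θ x = Real.sqrt x / (8 * Real.log x ^ α)
    have hb : 8 * Real.log x ^ α * Real.sqrt (D x) * x ^ (θ / 2) ≠ 0 :=
      mul_ne_zero (mul_ne_zero (mul_ne_zero (by norm_num) hlα0.ne') (Real.sqrt_pos.mpr hD0).ne')
        hxθ0.ne'
    have hd : (8 * Real.log x ^ α) ≠ 0 := mul_ne_zero (by norm_num) hlα0.ne'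
    rw [fiSLow, fiY, div_mul_div_comm, div_eq_div_iff hb hd]
    ring
  have hfS0 : 0 < fiSLow D α θ x := by
    unfold fiSLow
    exact div_pos (mul_pos hxθ0 hsqrt0) (mul_pos (mul_pos (by norm_num) hlα0) (Real.sqrt_pos.mpr hD0))
  obtain ⟨⟨k₀, rfl⟩, hslow, hsup⟩ := hs
  have hs0 : (0 : ℝ) < 2 ^ k₀ := by positivity
  have hsy_gt : u₀ < 2 ^ k₀ * y := by
    calc u₀ = fiSLow D α θ x * Y := hSY.symm
      _ < 2 ^ k₀ * Y := mul_lt_mul_of_pos_right hslow hY0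
      _ ≤ 2 ^ k₀ * y := mul_le_mul_of_nonneg_left hYy hs0.le
  have hsy0 : 0 ≤ 2 ^ k₀ * y := by linarith only [hu₀0, hsy_gt]
  have hfiSLow_le : fiSLow D α θ x ≤ x ^ 2 / 8 := by
    unfold fiSLow
    rw [div_le_div_iff₀ (by positivity) (by norm_num : (0 : ℝ) < 8)]
    have hLwx : x ^ (θ / 2) ≤ x := by
      calc x ^ (θ / 2) ≤ x ^ (1 : ℝ) := Real.rpow_le_rpow_of_exponent_le hx1 (by linarith only [hθ, hθ3])
        _ = x := Real.rpow_one x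
    have h2 : Real.sqrt x ≤ x := Real.sqrt_le_self_iff.mpr (Or.inr hx1)
    have h4 : 1 ≤ Real.sqrt (D x) := Real.one_le_sqrt.mpr hD1
    have hlα1 : 1 ≤ Real.log x ^ α := Real.one_le_rpow hlogx hα.le
    have h5 : x ^ (θ / 2) * Real.sqrt x ≤ x * x := mul_le_mul hLwx h2 hsqrt0.le hx0.le
    calc x ^ (θ / 2) * Real.sqrt x * 8 ≤ x * x * (8 * 1 * 1) := by linarith only [h5]
      _ ≤ x * x * (8 * Real.log x ^ α * Real.sqrt (D x)) := by
          refine mul_le_mul_of_nonneg_left ?_ (mul_nonneg hx0.le hx0.le)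
          exact mul_le_mul (mul_le_mul_of_nonneg_left hlα1 (by norm_num)) h4 zero_le_one
            (mul_nonneg (by norm_num) hlα0.le)
      _ = x ^ 2 * (8 * Real.log x ^ α * Real.sqrt (D x)) := by rw [sq]
  have hk₀ : (k₀ : ℝ) ≤ 4 * Real.log x := by
    refine nat_le_four_mul_log_of_two_pow_le ?_
    have hx2 : 0 ≤ x ^ 2 := sq_nonneg x
    linarith only [hsup, hfiSLow_le, hx2]
  -- `C₀ = ⌈x/D⌉`, `Dn = ⌊D⌋`
  set C₀ := ⌈x / D x⌉₊ with hC₀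
  have hxD0 : 0 < x / D x := div_pos hx0 hD0
  have hC1 : 1 ≤ C₀ := Nat.one_le_iff_ne_zero.mpr (Nat.pos_iff_ne_zero.mp (Nat.ceil_pos.mpr hxD0))
  have hC₀le : (C₀ : ℝ) < x / D x + 1 := Nat.ceil_lt_add_one hxD0.le
  have hC₀ge : x / D x ≤ C₀ := Nat.le_ceil _
  have hlogC₀ : Real.log C₀ ≤ 2 * Real.log x := by
    have h1 : (C₀ : ℝ) ≤ 2 * x := by
      have : x / D x ≤ x := div_le_self hx0.le hD1
      linarith only [this, hC₀le, hx1]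
    have h2 : Real.log C₀ ≤ Real.log (2 * x) := Real.log_le_log (by exact_mod_cast hC1) h1
    rw [Real.log_mul (by norm_num) hx0.ne'] at h2
    have h3 : Real.log 2 ≤ Real.log x := Real.log_le_log (by norm_num) (by linarith only [hx16])
    linarith only [h2, h3]
  set Dn := ⌊D x⌋₊ with hDn
  have hDn1 : 1 ≤ Dn := Nat.le_floor (by exact_mod_cast hD1)
  have hDfl : (Dn : ℝ) ≤ D x := Nat.floor_le hD0.le
  have hlogDn : Real.log Dn ≤ Real.log x :=
    Real.log_le_log (by exact_mod_cast hDn1) (hDfl.trans hDx.le)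
  have hDcond : ∀ d : ℕ, ((d * C₀ : ℕ) : ℝ) < x → d ≤ Dn := by
    intro d hd
    refine Nat.le_floor ?_
    have hC₀0 : (0 : ℝ) < C₀ := by exact_mod_cast hC1
    push_cast at hd
    have h1 : (d : ℝ) < x / C₀ := by rw [lt_div_iff₀ hC₀0]; exact hd
    have h2 : x / C₀ ≤ D x := by
      rw [div_le_iff₀ hC₀0]
      calc x = x / D x * D x := by field_simp
        _ ≤ C₀ * D x := mul_le_mul_of_nonneg_right hC₀ge hD0.le
        _ = D x * C₀ := mul_comm _ _
    linarith only [h1, h2]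
  -- `a₀ = ⌊sy/Lw⌋ ≥ x^{1/4}`
  obtain ⟨a₀, ha₀⟩ : ∃ a₀ : ℕ, a₀ = ⌊2 ^ k₀ * y / Lw⌋₊ := ⟨_, rfl⟩
  have hx14 : (2 : ℝ) ≤ x ^ (1 / 4 : ℝ) := by
    have h44 : ((4 : ℕ) : ℝ)⁻¹ = (1 / 4 : ℝ) := by norm_num
    have h2 : ((2 : ℝ) ^ (4 : ℕ)) ^ (1 / 4 : ℝ) = 2 := by
      rw [← h44]; exact Real.pow_rpow_inv_natCast zero_le_two four_ne_zero
    have h16x : (2 : ℝ) ^ (4 : ℕ) ≤ x := le_trans (by norm_num) hx16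
    have h3 : ((2 : ℝ) ^ (4 : ℕ)) ^ (1 / 4 : ℝ) ≤ x ^ (1 / 4 : ℝ) :=
      Real.rpow_le_rpow (pow_nonneg zero_le_two 4) h16x (by norm_num)
    rw [h2] at h3
    exact h3
  have ha₀ge : x ^ (1 / 4 : ℝ) ≤ a₀ := by
    -- `sy/Lw > u₀/Lw = x^{1/2-θ/2}/(8δ) ≥ 2 x^{1/4} ≥ x^{1/4} + 1`
    have h1 : u₀ / Lw ≤ 2 ^ k₀ * y / Lw := div_le_div_of_nonneg_right hsy_gt.le hLw0.le
    have h2 : x ^ (1 / 4 : ℝ) + 1 ≤ u₀ / Lw := by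
      rw [hu₀, hLw, div_div, le_div_iff₀ (mul_pos (mul_pos (by norm_num) hδ0) hxθ0)]
      have hx14' : (1 : ℝ) ≤ x ^ (1 / 4 : ℝ) := by linarith only [hx14]
      have hsplit : Real.sqrt x = x ^ (1 / 4 : ℝ) * (x ^ (1 / 4 - θ / 2 : ℝ) * x ^ (θ / 2)) := by
        rw [← Real.rpow_add hx0, ← Real.rpow_add hx0, Real.sqrt_eq_rpow]; norm_num
      rw [hsplit]
      have h3 : (x ^ (1 / 4 : ℝ) + 1) * (8 * δ * x ^ (θ / 2)) ≤ (2 * x ^ (1 / 4 : ℝ)) * (8 * δ * x ^ (θ / 2)) :=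
        mul_le_mul_of_nonneg_right (by linarith only [hx14']) (mul_pos (mul_pos (by norm_num) hδ0) hxθ0).le
      refine h3.trans ?_
      have h4 : 16 * δ ≤ x ^ (1 / 4 - θ / 2 : ℝ) := by rw [hδ]; linarith only [h16]
      calc 2 * x ^ (1 / 4 : ℝ) * (8 * δ * x ^ (θ / 2)) = x ^ (1 / 4 : ℝ) * ((16 * δ) * x ^ (θ / 2)) := by ring
        _ ≤ x ^ (1 / 4 : ℝ) * (x ^ (1 / 4 - θ / 2 : ℝ) * x ^ (θ / 2)) :=
            mul_le_mul_of_nonneg_left (mul_le_mul_of_nonneg_right h4 hxθ0.le) (Real.rpow_nonneg hx0.le _)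
    have h3 : x ^ (1 / 4 : ℝ) + 1 ≤ 2 ^ k₀ * y / Lw := h2.trans h1
    have h4 : 2 ^ k₀ * y / Lw - 1 < (⌊2 ^ k₀ * y / Lw⌋₊ : ℝ) := Nat.sub_one_lt_floor _
    rw [← ha₀] at h4
    generalize x ^ (1 / 4 : ℝ) = q at h3 ⊢
    generalize 2 ^ k₀ * y / Lw = r at h3 h4 ⊢
    linarith only [h3, h4]
  have ha₀2 : 2 ≤ a₀ := by
    have h2 : ((2 : ℕ) : ℝ) ≤ (a₀ : ℝ) := by rw [Nat.cast_ofNat]; exact hx14.trans ha₀ge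
    exact Nat.cast_le.mp h2
  have hloga₀ : Real.log x / 4 ≤ Real.log a₀ := by
    have := Real.log_le_log (Real.rpow_pos_of_pos hx0 _) ha₀ge
    rwa [Real.log_rpow hx0, show (1 / 4 : ℝ) * Real.log x = Real.log x / 4 by ring] at this
  have ha₀le : ∀ ν : ℕ, 1 ≤ ν → (ν : ℝ) ≤ Lw → a₀ ≤ ⌊2 ^ k₀ * y / ν⌋₊ := by
    intro ν hν hνL
    rw [ha₀]
    refine Nat.floor_le_floor ?_
    exact div_le_div_of_nonneg_left hsy0 (by exact_mod_cast hν) hνL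
  -- the analytic sums
  have hBe : ∑ e ∈ (Icc 1 X).filter Squarefree, A.density e * (e.divisors.card : ℝ) * sigmaHalf e ≤
      E₂ * Real.log x ^ 2 :=
    (sum_squarefree_density_card_sigmaHalf_le hg hK h19 hX2).trans
      (mul_le_mul_of_nonneg_left (pow_le_pow_left₀ hlogX0 hlogX 2) (Real.exp_pos _).le)
  have hSgs : ∑ ν ∈ (Icc 1 X).filter Squarefree, A.density ν * sigmaHalf ν ≤ E₁ * Real.log x :=
    (sum_squarefree_density_sigmaHalf_le hg hK h19 hX2).trans
      (mul_le_mul_of_nonneg_left hlogX (Real.exp_pos _).le)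
  have hSgs0 : 0 ≤ ∑ ν ∈ (Icc 1 X).filter Squarefree, A.density ν * sigmaHalf ν :=
    Finset.sum_nonneg fun ν hν => mul_nonneg
      (ArithmeticFunction.IsMultiplicative.nonneg_of_squarefree hg hg0 (Finset.mem_filter.mp hν).2)
      (le_trans zero_le_one (one_le_sigmaHalf ν))
  -- (R′) at `x`, with a nonnegative constant
  set R := KR' * A.size x / Real.log x ^ 3 with hRdef
  have hl3 : 0 < Real.log x ^ 3 := pow_pos hlogx0 3
  have hl5 : 0 < Real.log x ^ 5 := pow_pos hlogx0 5
  have hR0 : 0 ≤ R := div_nonneg (mul_nonneg hKR'0 hA0) hl3.le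
  have hRx' : ∀ t : ℝ, t ≤ x →
      ∑ d ∈ (Icc 1 Dn).filter Squarefree, (divisorCountK 5 d : ℝ) * |A.remainder d t| ≤ R := by
    intro t ht
    refine (hRx t ht).trans ?_
    exact div_le_div_of_nonneg_right (mul_le_mul_of_nonneg_right (le_max_left _ _) hA0) hl3.le
  -- (B′) on the dyadic pieces, for `z ∈ (Y, eY]` and integer truncations `j < C₀`
  set KBx := KB' * A.size x / Real.log x ^ 5 with hKBx
  have hKBx0 : 0 ≤ KBx := div_nonneg (mul_nonneg hKB'0 hA0) hl5.le
  have hB' : ∀ z ∈ Set.Ioc Y (Real.exp 1 * Y), ∀ j ∈ Ico 1 C₀, ∀ i ∈ range k₀,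
      ∑ m ∈ Icc 1 ⌊x⌋₊, (divisorCountK 5 m : ℝ) *
        |∑ n ∈ (Ioc ⌊2 ^ i * z⌋₊ ⌊2 * (2 ^ i * z)⌋₊).filter (fun n : ℕ => ((m * n : ℕ) : ℝ) ≤ x),
          (SieveSequence.fiGamma j n : ℝ) * (μ (m * n) : ℝ) * A.a (m * n)| ≤ KBx := by
    intro z hz j hj i hi
    have hi' : i < k₀ := Finset.mem_range.mp hi
    have hz0 : 0 < z := hY0.trans hz.1
    have hN1 : Real.sqrt (D x) / x ^ θ < 2 ^ i * z := by
      have hYlt : Real.sqrt (D x) / x ^ θ < Y := by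
        show Real.sqrt (D x) / x ^ θ < Real.sqrt (D x) / x ^ (θ / 2)
        refine div_lt_div_of_pos_left (Real.sqrt_pos.mpr hD0) hxθ0 ?_
        exact Real.rpow_lt_rpow_of_exponent_lt (by linarith only [hx16]) (by linarith only [hθ])
      calc Real.sqrt (D x) / x ^ θ < Y := hYlt
        _ < z := hz.1
        _ ≤ 2 ^ i * z := le_mul_of_one_le_left hz0.le (one_le_pow₀ one_le_two)
    have h2i : (2 : ℝ) ^ i ≤ 2 ^ k₀ / 2 := by
      rw [le_div_iff₀ two_pos, ← pow_succ]
      exact pow_le_pow_right₀ one_le_two (Nat.succ_le_of_lt hi')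
    have he8 : Real.exp 1 / 8 < 1 :=
      (div_lt_one (by norm_num : (0 : ℝ) < 8)).mpr (Real.exp_one_lt_d9.trans (by norm_num))
    have heY0 : 0 ≤ Real.exp 1 * Y := mul_nonneg (Real.exp_pos 1).le hY0.le
    have hq : 0 < Real.sqrt x / δ := div_pos hsqrt0 hδ0
    have hN2 : 2 ^ i * z < Real.sqrt x / δ := by
      have hfe : fiSLow D α θ x * (Real.exp 1 * Y) = (Real.exp 1 / 8) * (Real.sqrt x / δ) := by
        calc fiSLow D α θ x * (Real.exp 1 * Y) = Real.exp 1 * (fiSLow D α θ x * Y) := by ring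
          _ = Real.exp 1 * u₀ := by rw [hSY]
          _ = (Real.exp 1 / 8) * (Real.sqrt x / δ) := by rw [hu₀]; ring
      calc 2 ^ i * z ≤ (2 ^ k₀ / 2) * (Real.exp 1 * Y) := mul_le_mul h2i hz.2 hz0.le (div_nonneg hs0.le two_pos.le)
        _ ≤ fiSLow D α θ x * (Real.exp 1 * Y) :=
            mul_le_mul_of_nonneg_right (by linarith only [hsup]) heY0
        _ = (Real.exp 1 / 8) * (Real.sqrt x / δ) := hfe
        _ < 1 * (Real.sqrt x / δ) := mul_lt_mul_of_pos_right he8 hq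
        _ = Real.sqrt x / δ := one_mul _
    rw [hδ] at hN2
    have hj1 : (1 : ℝ) ≤ j := by exact_mod_cast (Finset.mem_Ico.mp hj).1
    have hjC : (j : ℝ) ≤ x / D x := by
      have hjlt : j + 1 ≤ C₀ := (Finset.mem_Ico.mp hj).2
      have : (j : ℝ) + 1 ≤ C₀ := by exact_mod_cast hjlt
      linarith only [this, hC₀le]
    have h0 := hBx (2 ^ i * z) hN1 hN2 j hj1 hjC
    refine h0.trans ?_
    exact div_le_div_of_nonneg_right (mul_le_mul_of_nonneg_right (le_max_left _ _) hA0) hl5.le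
  -- the pointwise bound for `z ∈ (Y, eY]`
  set B₀ := Kstar * A.size x / Real.log x + 2 * R * Real.log x + Real.log C₀ * k₀ * KBx with hB₀
  set Gf : ℝ → ℝ → ℝ := fun c z => ∑ d ∈ (Icc 1 Dn).filter Squarefree, ∑ k ∈ d.divisors,
      ((k.divisors.card : ℝ)) ^ 2 * |A.remainder d (min (c * ((k : ℝ) * z)) x)| with hGf
  have hGf0 : ∀ c z, 0 ≤ Gf c z := fun c z =>
    Finset.sum_nonneg fun d _ => Finset.sum_nonneg fun k _ => by positivity
  have hptw : ∀ z ∈ Set.Ioc Y (Real.exp 1 * Y),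
      |A.fiS3 (lam x) (2 ^ k₀) x y z| ≤ B₀ + Real.log x * (Gf 1 z + Gf (2 ^ k₀) z) := by
    intro z hz
    have hz0 : 0 < z := hY0.trans hz.1
    have hz1 : 1 ≤ z := le_trans (le_trans (Real.one_le_rpow hx1 hθ₁.le) hYP) hz.1.le
    have hPz : P ≤ z := hYP.trans hz.1.le
    have h3 := A.abs_fiS3_le_three h116 hw hPz hz1 hx0.le hC1 (s := 2 ^ k₀) (y := y)
    -- `S*`
    have hstar := A.abs_S3star_le hsize hg0 h24' hw hC1 hx1 hz0 hsy0 ha₀2 ha₀le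
    have hstar' : A.size x * ((∑ e ∈ (Icc 1 X).filter Squarefree,
        A.density e * (e.divisors.card : ℝ) * sigmaHalf e) *
        (∑ ℓ ∈ (Icc 1 X).filter Squarefree, A.density ℓ * sigmaHalf ℓ) *
        (2 * |K₂₄| * Real.log x / Real.log a₀ ^ 6) *
        ∑ ν ∈ (Icc 1 X).filter Squarefree, A.density ν * sigmaHalf ν) ≤ Kstar * A.size x / Real.log x := by
      have hl4 : 0 < Real.log x / 4 := div_pos hlogx0 four_pos
      have hloga₀0 : 0 < Real.log a₀ := lt_of_lt_of_le hl4 hloga₀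
      have h2K : 0 ≤ 2 * |K₂₄| * Real.log x := mul_nonneg (mul_nonneg two_pos.le (abs_nonneg _)) hlogx0.le
      have hCst : 2 * |K₂₄| * Real.log x / Real.log a₀ ^ 6 ≤ 2 * |K₂₄| * Real.log x / (Real.log x / 4) ^ 6 :=
        div_le_div_of_nonneg_left h2K (pow_pos hl4 6) (pow_le_pow_left₀ hl4.le hloga₀ 6)
      have hCst0 : 0 ≤ 2 * |K₂₄| * Real.log x / Real.log a₀ ^ 6 := div_nonneg h2K (pow_pos hloga₀0 6).le
      calc A.size x * ((∑ e ∈ (Icc 1 X).filter Squarefree,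
            A.density e * (e.divisors.card : ℝ) * sigmaHalf e) *
            (∑ ℓ ∈ (Icc 1 X).filter Squarefree, A.density ℓ * sigmaHalf ℓ) *
            (2 * |K₂₄| * Real.log x / Real.log a₀ ^ 6) *
            ∑ ν ∈ (Icc 1 X).filter Squarefree, A.density ν * sigmaHalf ν)
          ≤ A.size x * ((E₂ * Real.log x ^ 2) * (E₁ * Real.log x) *
            (2 * |K₂₄| * Real.log x / (Real.log x / 4) ^ 6) * (E₁ * Real.log x)) := by
            refine mul_le_mul_of_nonneg_left ?_ hA0
            refine mul_le_mul (mul_le_mul (mul_le_mul hBe hSgs hSgs0 (by positivity)) hCst hCst0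
              (by positivity)) hSgs hSgs0 (by positivity)
        _ = Kstar * A.size x / Real.log x := by
            rw [hKstar]
            field_simp
    -- `S'`
    have hMf : ∀ k, |(truncGT (μ : ArithmeticFunction ℝ) (2 ^ k₀ * y) * ζ) k| ≤ (k.divisors.card : ℝ) :=
      fun k => abs_truncGT_moebius_mul_zeta_le _ k
    have hprime := A.abs_S3prime_le hsize hw hx1 (2 ^ k₀) hz0.le hC1 hDcond
      (fun k => (truncGT (μ : ArithmeticFunction ℝ) (2 ^ k₀ * y) * ζ) k) hMf
    have hP1 : ∑ d ∈ (Icc 1 Dn).filter Squarefree, (divisorCountK 5 d : ℝ) *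
        ∑ n ∈ Icc 1 ⌊x⌋₊, |A.remainder d n| / n ≤ 2 * R * Real.log x := by
      have hswap : ∑ d ∈ (Icc 1 Dn).filter Squarefree, (divisorCountK 5 d : ℝ) *
          ∑ n ∈ Icc 1 ⌊x⌋₊, |A.remainder d n| / n =
          ∑ n ∈ Icc 1 ⌊x⌋₊, (1 / (n : ℝ)) * ∑ d ∈ (Icc 1 Dn).filter Squarefree,
            (divisorCountK 5 d : ℝ) * |A.remainder d n| := by
        simp only [Finset.mul_sum]
        rw [Finset.sum_comm]
        refine Finset.sum_congr rfl fun n _ => Finset.sum_congr rfl fun d _ => ?_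
        rw [div_eq_mul_one_div]; ring
      rw [hswap]
      calc ∑ n ∈ Icc 1 ⌊x⌋₊, (1 / (n : ℝ)) * ∑ d ∈ (Icc 1 Dn).filter Squarefree,
            (divisorCountK 5 d : ℝ) * |A.remainder d n|
          ≤ ∑ n ∈ Icc 1 ⌊x⌋₊, (1 / (n : ℝ)) * R := by
            refine Finset.sum_le_sum fun n hn => mul_le_mul_of_nonneg_left (hRx' n ?_)
              (div_nonneg zero_le_one (Nat.cast_nonneg n))
            exact le_trans (by exact_mod_cast (Finset.mem_Icc.mp hn).2) (Nat.floor_le hx0.le)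
        _ = (∑ n ∈ Icc 1 ⌊x⌋₊, (1 / (n : ℝ))) * R := by rw [Finset.sum_mul]
        _ ≤ (1 + Real.log X) * R := by
            refine mul_le_mul_of_nonneg_right ?_ hR0
            have heq : ∑ n ∈ Icc 1 X, (1 : ℝ) / n = (harmonic X : ℝ) := by
              rw [harmonic_eq_sum_Icc]
              push_cast
              exact Finset.sum_congr rfl fun n _ => by rw [one_div]
            rw [heq]
            exact harmonic_le_one_add_log X
        _ ≤ 2 * R * Real.log x := by
            have h := mul_le_mul_of_nonneg_right
              (show 1 + Real.log X ≤ 2 * Real.log x by linarith only [hlogX, hlogx]) hR0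
            linarith only [h]
    have hGeq : ∑ d ∈ (Icc 1 Dn).filter Squarefree, ∑ k ∈ d.divisors,
        ((k.divisors.card : ℝ)) ^ 2 *
          (|A.remainder d (min ((k : ℝ) * z) x)| + |A.remainder d (min ((k : ℝ) * (2 ^ k₀ * z)) x)|) =
        Gf 1 z + Gf (2 ^ k₀) z := by
      rw [hGf]
      dsimp only
      rw [← Finset.sum_add_distrib]
      refine Finset.sum_congr rfl fun d _ => ?_
      rw [← Finset.sum_add_distrib]
      refine Finset.sum_congr rfl fun k _ => ?_
      rw [one_mul, show (k : ℝ) * (2 ^ k₀ * z) = 2 ^ k₀ * ((k : ℝ) * z) by ring]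
      ring
    -- `S⁻`
    have hminus := abs_S3minus_le h116 hw hx0.le hz0.le k₀ hC1 (fun j hj i hi => hB' z hz j hj i hi)
      (lam := lam x) (y := y)
    -- combine
    refine h3.trans ?_
    rw [hGeq] at hprime
    have hsum := add_le_add (add_le_add (hstar.trans hstar') (hprime.trans
      (add_le_add hP1 le_rfl))) hminus
    refine hsum.trans (le_of_eq ?_)
    rw [hB₀]; ring
  -- integrate over `z ∈ [Y, eY]`
  have hYe : Y ≤ Real.exp 1 * Y := le_mul_of_one_le_left hY0.le he1
  have hGint : ∀ c, IntervalIntegrable (fun z => Gf c z / z) volume Y (Real.exp 1 * Y) := fun c =>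
    A.intervalIntegrable_boundary_terms hsize x Dn hY0 hYe c
  have hGbound : ∀ c, ∫ z in Y..(Real.exp 1 * Y), Gf c z / z ≤ (1 + Real.log Dn) * R := fun c =>
    A.integral_boundary_terms_le hsize hDn1 hRx' hY0 c
  set gfun : ℝ → ℝ := fun z => B₀ * z⁻¹ + Real.log x * (Gf 1 z / z) + Real.log x * (Gf (2 ^ k₀) z / z)
    with hgfun
  have hinvint : IntervalIntegrable (fun z : ℝ => B₀ * z⁻¹) volume Y (Real.exp 1 * Y) := by
    refine (intervalIntegral.intervalIntegrable_inv (fun u hu => ?_) continuousOn_id).const_mul _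
    rw [Set.uIcc_of_le hYe] at hu
    exact (hY0.trans_le hu.1).ne'
  have hgint : IntervalIntegrable gfun volume Y (Real.exp 1 * Y) :=
    (hinvint.add ((hGint 1).const_mul _)).add ((hGint (2 ^ k₀)).const_mul _)
  have hB₀0 : 0 ≤ B₀ := by
    have hC : 0 ≤ Real.log C₀ := Real.log_nonneg (by exact_mod_cast hC1)
    exact add_nonneg (add_nonneg (div_nonneg (mul_nonneg hKstar0 hA0) hlogx0.le)
      (mul_nonneg (mul_nonneg two_pos.le hR0) hlogx0.le))
      (mul_nonneg (mul_nonneg hC (Nat.cast_nonneg _)) hKBx0)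
  -- `|∫ S₃ dz/z| ≤ ∫ gfun`
  obtain ⟨Bd, hBd⟩ := A.exists_bound_fiS2_fiS3 (lam x) x
  have hfint : IntervalIntegrable (fun z => A.fiS3 (lam x) (2 ^ k₀) x y z / z) volume Y (Real.exp 1 * Y) := by
    refine intervalIntegrable_of_abs_le ((A.measurable_fiS3_right (lam x) (2 ^ k₀) x y).div measurable_id)
      (M := Bd / Y) fun z hz => ?_
    rw [Set.uIoc_of_le hYe] at hz
    have hz0 : 0 < z := hY0.trans hz.1
    show |A.fiS3 (lam x) (2 ^ k₀) x y z / z| ≤ Bd / Y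
    rw [abs_div, abs_of_pos hz0]
    calc |A.fiS3 (lam x) (2 ^ k₀) x y z| / z ≤ Bd / z :=
          div_le_div_of_nonneg_right (hBd (2 ^ k₀) y z).2 hz0.le
      _ ≤ Bd / Y := div_le_div_of_nonneg_left (le_trans (abs_nonneg _) (hBd (2 ^ k₀) y z).2) hY0 hz.1.le
  have hnorm : ∀ᵐ z : ℝ, z ∈ Set.Ioc Y (Real.exp 1 * Y) →
      ‖A.fiS3 (lam x) (2 ^ k₀) x y z / z‖ ≤ gfun z := by
    refine Filter.Eventually.of_forall fun z hz => ?_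
    have hz0 : 0 < z := hY0.trans hz.1
    rw [Real.norm_eq_abs, abs_div, abs_of_pos hz0, div_le_iff₀ hz0]
    refine (hptw z hz).trans (le_of_eq ?_)
    rw [hgfun]
    field_simp
    ring
  have hI : |A.fiS3Z (lam x) (2 ^ k₀) x y Y| ≤ ∫ z in Y..(Real.exp 1 * Y), gfun z := by
    have h := intervalIntegral.norm_integral_le_of_norm_le hYe hnorm hgint
    rw [Real.norm_eq_abs] at h
    simpa only [SieveSequence.fiS3Z, SieveSequence.logAvg] using h
  refine hI.trans ?_
  -- evaluate/bound `∫ gfun`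
  have hgsplit : ∫ z in Y..(Real.exp 1 * Y), gfun z =
      B₀ * (∫ z in Y..(Real.exp 1 * Y), z⁻¹) +
        Real.log x * (∫ z in Y..(Real.exp 1 * Y), Gf 1 z / z) +
        Real.log x * (∫ z in Y..(Real.exp 1 * Y), Gf (2 ^ k₀) z / z) := by
    rw [hgfun, intervalIntegral.integral_add (hinvint.add ((hGint 1).const_mul _)) ((hGint (2 ^ k₀)).const_mul _),
      intervalIntegral.integral_add hinvint ((hGint 1).const_mul _),
      intervalIntegral.integral_const_mul, intervalIntegral.integral_const_mul,
      intervalIntegral.integral_const_mul]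
  rw [hgsplit, show (∫ z in Y..(Real.exp 1 * Y), z⁻¹) = 1 from integral_inv_Ioc_exp_mul hY0, mul_one]
  have hlogDn' : (1 + Real.log Dn) * R ≤ 2 * Real.log x * R :=
    mul_le_mul_of_nonneg_right (by linarith only [hlogDn, hlogx]) hR0
  have hG1 := (hGbound 1).trans hlogDn'
  have hG2 := (hGbound (2 ^ k₀)).trans hlogDn'
  -- numerics
  have hKBx_le : Real.log C₀ * k₀ * KBx ≤ 8 * KB' * A.size x / Real.log x := by
    calc Real.log C₀ * k₀ * KBx ≤ (2 * Real.log x) * (4 * Real.log x) * KBx := by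
          refine mul_le_mul_of_nonneg_right (mul_le_mul hlogC₀ hk₀ (Nat.cast_nonneg _)
            (mul_nonneg two_pos.le hlogx0.le)) hKBx0
      _ = 8 * KB' * A.size x / Real.log x ^ 3 := by rw [hKBx]; field_simp; ring
      _ ≤ 8 * KB' * A.size x / Real.log x := by
          refine div_le_div_of_nonneg_left (mul_nonneg (mul_nonneg (by norm_num) hKB'0) hA0) hlogx0 ?_
          calc Real.log x = Real.log x ^ 1 := (pow_one _).symm
            _ ≤ Real.log x ^ 3 := pow_le_pow_right₀ hlogx (by norm_num)
  have hRlog : 2 * R * Real.log x ≤ 2 * KR' * A.size x / Real.log x := by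
    rw [hRdef]
    have : 2 * (KR' * A.size x / Real.log x ^ 3) * Real.log x = 2 * KR' * A.size x / Real.log x ^ 2 := by
      field_simp
    rw [this]
    refine div_le_div_of_nonneg_left (mul_nonneg (mul_nonneg two_pos.le hKR'0) hA0) hlogx0 ?_
    calc Real.log x = Real.log x ^ 1 := (pow_one _).symm
      _ ≤ Real.log x ^ 2 := pow_le_pow_right₀ hlogx (by norm_num)
  have hRlog2 : Real.log x * (2 * Real.log x * R) = 2 * KR' * A.size x / Real.log x := by
    rw [hRdef]; field_simp
  calc B₀ + Real.log x * (∫ z in Y..(Real.exp 1 * Y), Gf 1 z / z) +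
        Real.log x * (∫ z in Y..(Real.exp 1 * Y), Gf (2 ^ k₀) z / z)
      ≤ B₀ + Real.log x * (2 * Real.log x * R) + Real.log x * (2 * Real.log x * R) := by
        refine add_le_add (add_le_add le_rfl ?_) ?_
        · exact mul_le_mul_of_nonneg_left hG1 hlogx0.le
        · exact mul_le_mul_of_nonneg_left hG2 hlogx0.le
    _ ≤ Kstar * A.size x / Real.log x + 2 * KR' * A.size x / Real.log x +
          8 * KB' * A.size x / Real.log x + 2 * KR' * A.size x / Real.log x +
          2 * KR' * A.size x / Real.log x := by
        rw [hRlog2, hB₀]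
        linarith only [hKBx_le, hRlog]
    _ = (Kstar + 8 * KB' + 6 * KR') * A.size x / Real.log x := by ring

end Literature.NumberTheory.Sieve
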